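import Summits.BirchSwinnertonDyer.BirchSwinnertonDyer.Theorems.EisensteinPrimesAcTwistDeformationCurveSUROfTateTC
import HarnessLib

/-!
# v30 «SurC» re-typing of `EisensteinPrimesAcTwistDeformationCurveSUROfTateTC`: Greenberg 2016 Prop. 2.6.3 by name ↦ its case (c) at totally complex `K` by name

Route `EisensteinPrimes` (rung K5), crux 2 `GoodLatticeBDPValue` (stmt-BirchSwinnertonDyer-19032), line `halves`;
cell `bsd-eis`, width seat `bsd-line-x1-p1-w5` gen 9 for LEAD g9 (LEAD ROUTING #3, 2026-08-29), helper (`--supports`).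

This file re-types, token for token, the theorems of `EisensteinPrimesAcTwistDeformationCurveSUROfTateTC` that carry Greenberg 2016
Prop. 2.6.3 = Greenberg 2010 Prop. 3.2.1 BY NAME (`h263 : Greenberg2016.prop263_sur_of_crk`: SUR(𝐃, 𝓛) from
LEO + CRK + (a) ∨ (b) ∨ (c), every number field) with that hypothesis replaced by its CASE (c) AT TOTALLY
COMPLEX FIELDS (`h263 : Greenberg2016.prop263_sur_of_crk_caseC_tc`, the special case p696608 appended to
`Literature/…/Greenberg2016/GlobalToLocalSurjectivity.lean`): every leaf of the line applies Prop. 2.6.3 in case (c)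
(`η = 𝔭`, `Q_𝓛(K_𝔭, 𝐃) = 0` divisible) at an imaginary quadratic — hence totally complex — `K`, so the weaker
hypothesis suffices; the special case is the END STATEMENT of the cell's kernel road «SUR-Λ»
(`prop263_sur_of_crk_caseC_tc_holds`, from the tree's Poitou–Tate at totally complex fields), after which the
LEAD drops the name from the line (v30).  Statements are otherwise VERBATIM (same binder order, new names
`<name>_ofSurC`); proofs are the tree proofs with the last argument of the leaf call, the third-disjunct
injection of the case-(c) witness, replaced by the witness itself (the `IsTotallyComplex K` instance being
supplied from `IsImaginaryQuadratic K`) and the re-typed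
callees called; helpers without `h263` are used from the imported `…OfTateTC` file unchanged.

Theorems only; no definition, no named fact, no `sorry`, no instance. HONEST FRAMING: conditional on the PUBLISHED
named facts carried as hypotheses; closes nothing by itself; no summit statement / BSD / the crux is proved here.

## References
* R. Greenberg, *On the structure of Selmer groups*, Springer PROMS 188 (2016), Prop. 2.6.3 (§2.6 p. 10). [Greenberg2016Selmer]
* R. Greenberg, *Surjectivity of the global-to-local map defining a Selmer group*, Kyoto J. Math. 50 (2010), Prop. 3.2.1 (c) (p. 15). [Greenberg2010]
* (the references of the re-typed file apply verbatim)
-/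

set_option autoImplicit false
-- `Summit.<P>.<Sub>` repeats `BirchSwinnertonDyer` by the tree's layout convention (D-0017)
set_option linter.dupNamespace false

noncomputable section

open scoped Classical
open NumberField IsDedekindDomain Field Finset
open Literature.NumberTheory.EllipticCurves Literature.NumberTheory.GaloisRepresentations
  Literature.NumberTheory.IwasawaTheory Literature.NumberTheory.IwasawaTheory.Greenberg2016
  Literature.NumberTheory.IwasawaTheory.Greenberg2006
  Summit.BirchSwinnertonDyer.BirchSwinnertonDyer.Theorems.TwistDeformationCofree
  Summit.BirchSwinnertonDyer.BirchSwinnertonDyer.Theorems.GreenbergFullAtSelmer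
  Summit.BirchSwinnertonDyer.BirchSwinnertonDyer.Theorems.SignedBaseChangeAcDivGreenbergSqueeze

namespace Summit.BirchSwinnertonDyer.BirchSwinnertonDyer.Theorems.AcTwistDeformation

section DualBasisForm

variable {K : Type} [Field K] [NumberField K] {S : Set (HeightOneSpectrum (𝓞 K))} {p : ℕ} [Fact p.Prime]
  {A : Type} [AddCommGroup A] [Module ℤ_[p] A] [TopologicalSpace A] [DiscreteTopology A]
  [TopologicalSpace (PowerSeries ℤ_[p])] [IsTopologicalRing (PowerSeries ℤ_[p])]
  [IsTopologicalAddGroup (BigRepModule ℤ_[p] p A)]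
  [ContinuousSMul (PowerSeries ℤ_[p]) (BigRepModule ℤ_[p] p A)]
  (hS : ∀ v : HeightOneSpectrum (𝓞 K), ((p : ℕ) : 𝓞 K) ∈ v.asIdeal → v ∈ S)
  (κ : ZpExtension K p) (ρ₀ : ContinuousRep (GaloisGroupUnramifiedOutside K S) ℤ_[p] A) {n : ℕ}

/-- **[v30 `OfSurC` re-typing: Greenberg 2016 Prop. 2.6.3 by name ↦ its case (c) at totally complex `K` by name (`prop263_sur_of_crk_caseC_tc`).]** [cite: Greenberg2010, Prop. 3.2.1 (c) (p. 15)] **[T28b `OfTateTC` re-typing: Greenberg 2006 Prop. 3.2 by name ↦ Milne ADT I Thm. 5.1 by name AT TOTALLY COMPLEX FIELDS (Prop. 3.2 is read in degrees ≤ 2 and at totally complex fields only, `prop32_global_le_two_of_tate_tc`).]** [cite: MilneADT2006, I Thm. 5.1 (p. 67)] **SUR(`𝐃`, `𝓛_𝔭`) — Greenberg 2016 Prop. 2.6.3 (c) for the one-variable twist deformation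
`𝐃 = bigRep κ ρ₀` of a `p`-primary `A` with a rank-`n` Pontryagin dual-basis family** (e.g. `A = E[p^∞]`, `n = 2`) over a `ℤ_p`-extension `κ` of an
IMAGINARY QUADRATIC `K` with `p = 𝔭𝔭̄` split: the global-to-local map
`φ_{𝓛_𝔭} : H¹(K_Σ/K, 𝐃) → ∏_{w∈Σ} H¹(K_w, 𝐃)/L_w` (`L_𝔭 = ⊤`, `L_w = 0` for `w ≠ 𝔭`) IS SURJECTIVE, GRANTED
five published facts by name (Greenberg 2016 Prop. 2.6.3; Greenberg 2006 Props. 4.1, 4.2, §5 A, 3.2),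
`h⁰ = 0` and LOC⁽¹⁾ at the places of `S`, and `corank_Λ S_{𝓛_𝔭}(K, 𝐃) = 0`. DISCHARGED here: `𝐃` divisible / cofree /
corank `n` / `p`-primary (`…CofreeRank`); LEO and CRK by the squeeze (`bigRep_leo_crk_of_dualBasis_ofTateTC`); condition (c)
at `𝔭` (`Q_𝔭 = 0`).
[cite: Greenberg2016Selmer, Prop. 2.6.3 (c) (§2.6 p. 10 L13–22), §4.3 p. 20 L19–30]
[cite: Greenberg2010, Prop. 3.2.1 (p. 15)] [cite: Greenberg2006, Prop. 3.2 p. 358, Props. 4.1–4.2 (§4 A pp. 367–368), §5 A (p. 373)] -/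
theorem bigRep_fullAt_SUR_of_dualBasis_ofSurC (h263 : prop263_sur_of_crk_caseC_tc) (h41 : prop41_globalEulerPoincareCorank)
    (h42 : prop42_localEulerPoincareCorank) (h5A : sec5A_localH2_subsingleton_of_LOC1)
    (h32 : (∀ (L : Type) [Field L] [NumberField L] [IsTotallyComplex L], Literature.NumberTheory.GaloisCohomology.tateGlobalEulerPoincareCharacteristic L))
    (hSf : S.Finite) (hK : IsImaginaryQuadratic K) (hA : ∀ a : A, ∃ k : ℕ, p ^ k • a = 0)
    (jQ : Fin n → (A →+ AddCircle (1 : ℚ)))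
    (hinjQ : ∀ c : Fin n → ℤ_[p], (∀ a : A, ∑ k, jQ k (c k • a) = 0) → c = 0)
    (hsurjQ : ∀ φ : A →+ AddCircle (1 : ℚ), ∃ c : Fin n → ℤ_[p], ∀ a : A, φ a = ∑ k, jQ k (c k • a))
    (h0loc : ∀ v : HeightOneSpectrum (𝓞 K), v ∈ S →
      HasCorank (PowerSeries ℤ_[p])
        ((localRep S (bigRep (κ.liftUnramifiedOutside S hS) ρ₀) (Sum.inr v)).H 0) 0)
    (hLOC1fin : ∀ v : HeightOneSpectrum (𝓞 K), v ∈ S →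
      LOC1 S (bigRep (κ.liftUnramifiedOutside S hS) ρ₀) (Sum.inr v))
    {𝔭 𝔭bar : HeightOneSpectrum (𝓞 K)} (hne : 𝔭bar ≠ 𝔭)
    (hp𝔭 : ((p : ℕ) : 𝓞 K) ∈ 𝔭.asIdeal) (hp𝔭bar : ((p : ℕ) : 𝓞 K) ∈ 𝔭bar.asIdeal)
    (hSel : HasCorank (PowerSeries ℤ_[p])
      (fullAtSpecification S (bigRep (κ.liftUnramifiedOutside S hS) ρ₀) (Sum.inr 𝔭)).selmer 0) :
    (fullAtSpecification S (bigRep (κ.liftUnramifiedOutside S hS) ρ₀) (Sum.inr 𝔭)).SUR := by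
  haveI : IsTotallyComplex K := hK.2
  set ρ := bigRep (κ.liftUnramifiedOutside S hS) ρ₀ with hρ
  -- standing clauses of the arena at `Λ = R = ℤ_p⟦T⟧`
  have hΛ := nonempty_iwasawaAlgebra_ringEquiv_mvPowerSeries p
  have hcpl := isAdicComplete_maximalIdeal_iwasawaAlgebra p
  have hres := finite_residueField_iwasawaAlgebra p
  have hchar := charP_residueField_iwasawaAlgebra p
  have hinjΛ : Function.Injective (algebraMap (PowerSeries ℤ_[p]) (PowerSeries ℤ_[p])) :=
    fun a b h ↦ by simpa using h
  have hfin : Module.Finite (PowerSeries ℤ_[p]) (PowerSeries ℤ_[p]) := inferInstance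
  have hlin : ∀ (g : GaloisGroupUnramifiedOutside K S) (r : PowerSeries ℤ_[p])
      (d : BigRepModule ℤ_[p] p A), ρ g (r • d) = r • ρ g d := fun g r d ↦ map_smul (ρ g) r d
  -- the instance data from the dual basis
  have hdiv := isDivisible_bigRepModule_pi hA jQ hinjQ hsurjQ
  have hT := isCofree_bigRepModule_pi hA jQ hinjQ hsurjQ
  have hpD : ∀ d : BigRepModule ℤ_[p] p A, ∃ n : ℕ, (p ^ n : ℤ) • d = 0 := exists_zpow_smul_eq_zero
  -- the squeeze: LEO, CRK
  obtain ⟨hLEO, hCRK, -, -⟩ := bigRep_leo_crk_of_dualBasis_ofTateTC hS κ ρ₀ h41 h42 h5A h32 hSf hK hA jQ hinjQ hsurjQ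
    h0loc hLOC1fin hne hp𝔭 hp𝔭bar hSel
  -- condition (c) at `η = 𝔭`: LOC⁽¹⁾ and `Q_𝔭 = 0` divisible
  have hQ𝔭 : IsDivisible (PowerSeries ℤ_[p]) ((fullAtSpecification S ρ (Sum.inr 𝔭)).Q (Sum.inr 𝔭)) := by
    haveI : Subsingleton ((fullAtSpecification S ρ (Sum.inr 𝔭)).Q (Sum.inr 𝔭)) :=
      Submodule.Quotient.subsingleton_iff.mpr (fullAtSpecification_self (Sum.inr 𝔭))
    exact fun θ _ s ↦ ⟨s, Subsingleton.elim _ _⟩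
  -- Prop. 2.6.3 (c)
  exact h263 p K S hSf hS (PowerSeries ℤ_[p]) 1 hΛ (PowerSeries ℤ_[p]) hinjΛ hfin hcpl hres hchar
    (BigRepModule ℤ_[p] p A) ρ hlin hT hpD (fullAtSpecification S ρ (Sum.inr 𝔭))
    (fullAtSpecification_isStable (Sum.inr 𝔭) hlin) hdiv hLEO hCRK
    ⟨𝔭, hS 𝔭 hp𝔭, hLOC1fin 𝔭 (hS 𝔭 hp𝔭), hQ𝔭⟩

end DualBasisForm

section CurveLocal

variable {K : Type} [Field K] [NumberField K] (S : Set (HeightOneSpectrum (𝓞 K))) {p : ℕ} [Fact p.Prime]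
  (W : WeierstrassCurve K) [W.IsElliptic]
  [TopologicalSpace (PowerSeries ℤ_[p])]
  [IsTopologicalAddGroup (BigRepModule ℤ_[p] p (PrimaryTorsion W.geomPoints p))]
  [ContinuousSMul (PowerSeries ℤ_[p]) (BigRepModule ℤ_[p] p (PrimaryTorsion W.geomPoints p))]
  (hS : ∀ v : HeightOneSpectrum (𝓞 K), ((p : ℕ) : 𝓞 K) ∈ v.asIdeal → v ∈ S)
  (κ : ZpExtension K p)
  (ρ₀ : ContinuousRep (GaloisGroupUnramifiedOutside K S) ℤ_[p] (PrimaryTorsion W.geomPoints p))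

end CurveLocal

section CurveSUR

variable {K : Type} [Field K] [NumberField K] {S : Set (HeightOneSpectrum (𝓞 K))} {p : ℕ} [Fact p.Prime]
  (W : WeierstrassCurve K) [W.IsElliptic]
  [TopologicalSpace (PowerSeries ℤ_[p])] [IsTopologicalRing (PowerSeries ℤ_[p])]
  [IsTopologicalAddGroup (BigRepModule ℤ_[p] p (PrimaryTorsion W.geomPoints p))]
  [ContinuousSMul (PowerSeries ℤ_[p]) (BigRepModule ℤ_[p] p (PrimaryTorsion W.geomPoints p))]
  (hS : ∀ v : HeightOneSpectrum (𝓞 K), ((p : ℕ) : 𝓞 K) ∈ v.asIdeal → v ∈ S)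
  (κ : ZpExtension K p)
  (ρ₀ : ContinuousRep (GaloisGroupUnramifiedOutside K S) ℤ_[p] (PrimaryTorsion W.geomPoints p))

/-- **[v30 `OfSurC` re-typing: Greenberg 2016 Prop. 2.6.3 by name ↦ its case (c) at totally complex `K` by name (`prop263_sur_of_crk_caseC_tc`).]** [cite: Greenberg2010, Prop. 3.2.1 (c) (p. 15)] **[T28b `OfTateTC` re-typing: Greenberg 2006 Prop. 3.2 by name ↦ Milne ADT I Thm. 5.1 by name AT TOTALLY COMPLEX FIELDS (Prop. 3.2 is read in degrees ≤ 2 and at totally complex fields only, `prop32_global_le_two_of_tate_tc`).]** [cite: MilneADT2006, I Thm. 5.1 (p. 67)] **SUR(`𝐃_E`, `𝓛_𝔭`) — Greenberg 2016 Prop. 2.6.3 (c) for `𝐃_E = E[p^∞] ⊗ Λ^*(κ⁻¹)`**: for an elliptic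
`W/K`, `K` imaginary quadratic, `p = 𝔭𝔭̄`, `S ⊇ {w ∣ p}` finite with a `σ`-supply (no place of `S` splits
completely in `K_∞`), and ANY continuous `ℤ_p`-linear `ρ₀` of `G_{K,S}` on `E[p^∞]`, the global-to-local map
`φ_{𝓛_𝔭} : H¹(K_Σ/K, 𝐃_E) → ∏_{w∈Σ} H¹(K_w, 𝐃_E)/L_w` (`L_𝔭 = ⊤`, `L_w = 0` else) IS SURJECTIVE, granted the
five published facts by name and `corank_Λ S_{𝓛_𝔭}(K, 𝐃_E) = 0`. With `…SurOfSUR` this is the V21 road's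
SUR_f at `v̄` (`U(E[p^∞]) ↠ ⊕_{j<s} H¹(K_{∞,w_j}, E[p^∞])`), modulo that one input.
[cite: Greenberg2016Selmer, Prop. 2.6.3 (c) (§2.6 p. 10), §4.3 pp. 20–21] [cite: Greenberg2010, Prop. 3.2.1, Lemma 5.2.2]
[cite: PollackWeston2011, App. A Prop. A.2 (the same surjectivity, r_v = 2)] -/
theorem primaryTorsion_fullAt_SUR_ofSurC (h263 : prop263_sur_of_crk_caseC_tc) (h41 : prop41_globalEulerPoincareCorank)
    (h42 : prop42_localEulerPoincareCorank) (h5A : sec5A_localH2_subsingleton_of_LOC1)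
    (h32 : (∀ (L : Type) [Field L] [NumberField L] [IsTotallyComplex L], Literature.NumberTheory.GaloisCohomology.tateGlobalEulerPoincareCharacteristic L))
    (hSf : S.Finite) (hK : IsImaginaryQuadratic K)
    (hsup : ∀ v : HeightOneSpectrum (𝓞 K), v ∈ S →
      ∃ σ : absoluteGaloisGroup (Place.Completion (Sum.inr v : Place K)),
        κ (absGaloisRestrict K _ σ) ≠ 1)
    {𝔭 𝔭bar : HeightOneSpectrum (𝓞 K)} (hne : 𝔭bar ≠ 𝔭)
    (hp𝔭 : ((p : ℕ) : 𝓞 K) ∈ 𝔭.asIdeal) (hp𝔭bar : ((p : ℕ) : 𝓞 K) ∈ 𝔭bar.asIdeal)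
    (hSel : HasCorank (PowerSeries ℤ_[p])
      (fullAtSpecification S (bigRep (κ.liftUnramifiedOutside S hS) ρ₀) (Sum.inr 𝔭)).selmer 0) :
    (fullAtSpecification S (bigRep (κ.liftUnramifiedOutside S hS) ρ₀) (Sum.inr 𝔭)).SUR := by
  obtain ⟨hA, jQ, jU, hinjQ, hsurjQ, -, -⟩ := exists_dualBases_primaryTorsion W p
  have hloc := fun v (hv : v ∈ S) ↦
    localH0_and_LOC1_primaryTorsion S W hS κ ρ₀ (Sum.inr v) (hsup v hv).choose (hsup v hv).choose_spec
  exact bigRep_fullAt_SUR_of_dualBasis_ofSurC hS κ ρ₀ h263 h41 h42 h5A h32 hSf hK hA jQ hinjQ hsurjQ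
    (fun v hv ↦ (hloc v hv).1) (fun v hv ↦ (hloc v hv).2) hne hp𝔭 hp𝔭bar hSel

end CurveSUR

end Summit.BirchSwinnertonDyer.BirchSwinnertonDyer.Theorems.AcTwistDeformation

end
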